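import Mathlib
import Summits.ValiantsHypothesis.ValiantsHypothesis.Theorems.BarrierLeverPartitionMinorsHitByVPSimplexJoinTwoSlotsLevels
import Summits.ValiantsHypothesis.ValiantsHypothesis.Theorems.BarrierLeverPartitionMinorsHitByVPSimplexJoinPatternTwoOne
import Summits.ValiantsHypothesis.ValiantsHypothesis.Theorems.BarrierLeverPartitionMinorsHitByVPHiddenStatesUniversalConstraints

/-!
# Route BarrierLever — item `PartitionMinorsHitByVP` (19717): `Stmt.pieceKill`, shallow pattern (1,1)
Helper file (`--supports stmt-ValiantsHypothesis-19717`; cell valiant-natproofs, 𝒟-side door (c), line `hidden_states`, uniform-menu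
lane; prover seat val-np-p3 gen 12). Definition-free; closes NO item. Third SHALLOW case of the case map toward `Stmt.pieceKill H₀`
(memo val-np-p3 g12 §2(g), pattern (P2)): a one-piece exact-support design with two MEDIUM slots (`h+1 ≤ s₂ ≤ s₁ < 1+h+C(h,2)`, levels
(1,1) at `univ`) and `n = (s₁+1)(s₂+1)` columns is defeated for every table (`pieceKill_pattern11`, `h ≥ 2^40`). Three leaves:
* `s₁ ≥ 7(s₂+1)` (lopsided): levels (2,1) inside `|A| = ⌊√(2s₁)⌋ − 1` coordinates, all `n` rows of size `≤ 4` (`arith11_lopsided`);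
* else, if `(s₁+1)(s₂+1) < C(h,≤3) + (s₁−h)(s₂−h)`: the rank form (1,1) at `univ` with the `n` smallest rows;
* else (`s₂ ≳ h²/48`): levels (2,2) inside `|A| = ⌊√s₂⌋` coordinates, all `n` rows of size `≤ 5` (`arith11_wide`).
(The "unbalanced" leaf `s₂ < √(2s₁)` is empty: `√(2s₁) < h+1 ≤ s₂`.) Tools: `det_eq_zero_of_two_slots_levels_rank` (p629996),
`UniversalConstraints.rowsSmallFirst` (g6), `arith21_pow` (p635134). Nothing on crux 14610 or VP ≠ VNP.
-/

set_option linter.dupNamespace false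

namespace Summit.ValiantsHypothesis.ValiantsHypothesis.Theorems.BarrierLever.SimplexJoin

open Finset Matrix
open Summit.ValiantsHypothesis.ValiantsHypothesis.Theorems.BarrierLever.HiddenStates.UniversalConstraints
  (rowsSmallFirst rowsSmallFirst_injective card_small_rowsSmallFirst)

/-- Arithmetic of the lopsided leaf: `24(s₁+1)(s₂+1) ≤ (q−4)⁴` for `q = ⌊√(2s₁)⌋`, `7(s₂+1) ≤ s₁`, `q ≥ 2^10`. -/
theorem arith11_lopsided (s₁ s₂ q : ℕ) (hq : 2 ^ 10 ≤ q) (hq1 : q * q ≤ 2 * s₁) (hq2 : 2 * s₁ < (q + 1) * (q + 1))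
    (h7 : 7 * (s₂ + 1) ≤ s₁) : 24 * ((s₁ + 1) * (s₂ + 1)) ≤ (q - 4) ^ 4 := by
  obtain ⟨w, rfl⟩ : ∃ w, q = w + 4 := ⟨q - 4, by omega⟩
  rw [show w + 4 - 4 = w by omega]
  have hw : 1000 ≤ w := by omega
  have A1 : 28 * (24 * ((s₁ + 1) * (s₂ + 1))) ≤ 96 * (s₁ * (s₁ + 1)) := by nlinarith
  have A2 : 2 * s₁ ≤ (w + 5) * (w + 5) := by nlinarith
  have A3 : 96 * (s₁ * (s₁ + 1)) ≤ 24 * ((w + 5) * (w + 5)) * ((w + 5) * (w + 5) + 2) := by nlinarith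
  have G2 : 1000 * (w * (w * w)) ≤ w * (w * (w * w)) := Nat.mul_le_mul_right _ hw
  have G3 : 1000 * (w * w) ≤ w * (w * w) := Nat.mul_le_mul_right _ hw
  have G4 : 1000 * w ≤ w * w := Nat.mul_le_mul_right _ hw
  nlinarith [A1, A3, G2, G3, G4]

/-- Arithmetic of the wide leaf: if `(h−2)³ ≤ 48(h+1)t²` (`t = ⌊√s₂⌋ + 1`, `h ≥ 2^40`) then `120·7·t⁴ ≤ (t−5)⁵`. -/
theorem arith11_wide (h t : ℕ) (hh : 2 ^ 40 ≤ h) (ht : (h - 2) ^ 3 ≤ 48 * (h + 1) * (t * t)) :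
    120 * (7 * ((t * t) * (t * t))) ≤ (t - 5) ^ 5 := by
  obtain ⟨c, rfl⟩ : ∃ c, h = c + 2 := ⟨h - 2, by omega⟩
  rw [show c + 2 - 2 = c by omega] at ht
  have hc : 2 ^ 39 ≤ c := by omega
  have hct : 2 ^ 30 ≤ t := by
    by_contra hlt
    push Not at hlt
    have h1 : t * t ≤ 2 ^ 30 * 2 ^ 30 := Nat.mul_le_mul hlt.le hlt.le
    have h2 : 48 * (c + 2 + 1) * (t * t) ≤ 48 * (c + 2 + 1) * (2 ^ 30 * 2 ^ 30) := Nat.mul_le_mul_left _ h1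
    have h3 : 2 ^ 39 * (2 ^ 39 * c) ≤ c * (c * c) := by
      have := Nat.mul_le_mul hc (Nat.mul_le_mul_right c hc)
      simpa [mul_comm, mul_assoc, mul_left_comm] using this
    nlinarith [h2, h3]
  obtain ⟨w, rfl⟩ : ∃ w, t = w + 5 := ⟨t - 5, by omega⟩
  rw [show w + 5 - 5 = w by omega]
  have hw : 2 ^ 29 ≤ w := by omega
  have G2 : 2 ^ 29 * (w * (w * (w * w))) ≤ w * (w * (w * (w * w))) := Nat.mul_le_mul_right _ hw
  have G3 : 2 ^ 29 * (w * (w * w)) ≤ w * (w * (w * w)) := Nat.mul_le_mul_right _ hw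
  have G4 : 2 ^ 29 * (w * w) ≤ w * (w * w) := Nat.mul_le_mul_right _ hw
  have G5 : 2 ^ 29 * w ≤ w * w := Nat.mul_le_mul_right _ hw
  nlinarith [G2, G3, G4, G5]

/-- `C(a,≤2) ≤ a²` for `a ≥ 2`. -/
theorem sum_choose_three_le_sq (a : ℕ) (ha : 2 ≤ a) : ∑ i ∈ Finset.range 3, a.choose i ≤ a * a := by
  have h1 := Nat.descFactorial_eq_factorial_mul_choose a 2
  have h2 : a.descFactorial 2 = (a - 1) * a := by simp [Nat.descFactorial_succ]
  simp only [Nat.factorial_two] at h1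
  simp only [Finset.sum_range_succ, Finset.sum_range_zero, Nat.choose_zero_right, Nat.choose_one_right, zero_add]
  obtain ⟨k, rfl⟩ : ∃ k, a = k + 2 := ⟨a - 2, by omega⟩
  rw [show k + 2 - 1 = k + 1 by omega] at h2
  have hPQ : (k + 2) * (k + 2) = (k + 1) * (k + 2) + (k + 2) := by ring
  have hP : 2 ≤ (k + 1) * (k + 2) := Nat.mul_le_mul (by omega : 1 ≤ k + 1) (by omega : 2 ≤ k + 2)
  omega

set_option maxHeartbeats 400000 in
/-- **Pattern (1,1) of `Stmt.pieceKill`.** A one-piece exact-support design with two medium slots (`h+1 ≤ s₂ ≤ s₁ < 1+h+C(h,2)`) and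
`n = (s₁+1)(s₂+1)` columns has an injective row family on which every table is singular (`h ≥ 2^40`). -/
theorem pieceKill_pattern11 (h D N n : ℕ) (hh : 2 ^ 40 ≤ h) (S : Fin 1 → Fin D → Finset (Fin N))
    (e : Fin n → Fin 1 × (Fin D → Option (Fin N))) (he : Function.Injective e)
    (hlive : ∀ c : Fin 1 × (Fin D → Option (Fin N)),
      c ∈ Set.range e ↔ ∀ (f : Fin D) (j : Fin N), c.2 f = some j → j ∈ S c.1 f)
    (f₁ f₂ : Fin D) (hf : f₁ ≠ f₂)
    (hs₁ : ∑ i ∈ Finset.range 2, h.choose i ≤ (S 0 f₁).card) (hs₁c : (S 0 f₁).card < ∑ i ∈ Finset.range 3, h.choose i)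
    (hs₂ : ∑ i ∈ Finset.range 2, h.choose i ≤ (S 0 f₂).card) (hs₂₁ : (S 0 f₂).card ≤ (S 0 f₁).card)
    (hn : n = ((S 0 f₁).card + 1) * ((S 0 f₂).card + 1)) :
    ∃ v : Fin n → Finset (Fin h), Function.Injective v ∧
      ∀ T : Fin 1 → Option (Fin D × Fin N) → Fin h → ℂ,
        (Matrix.of fun x x' : Fin n => ∏ a ∈ v x,
          (T (e x').1 none a + ∑ f : Fin D, ((e x').2 f).elim 0 fun j => T (e x').1 (some (f, j)) a)).det = 0 := by
  classical
  set s₁ := (S 0 f₁).card with hs₁def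
  set s₂ := (S 0 f₂).card with hs₂def
  -- `2·C(h,≤2) = h² + h + 2`
  have hc₂ : 2 * ∑ i ∈ Finset.range 3, h.choose i = h * h + h + 2 := by
    have h1 := Nat.descFactorial_eq_factorial_mul_choose h 2
    have h2 : h.descFactorial 2 = (h - 1) * h := by simp [Nat.descFactorial_succ]
    simp only [Nat.factorial_two] at h1
    simp only [Finset.sum_range_succ, Finset.sum_range_zero, Nat.choose_zero_right, Nat.choose_one_right, zero_add]
    obtain ⟨k, rfl⟩ : ∃ k, h = k + 1 := ⟨h - 1, by omega⟩
    rw [show k + 1 - 1 = k by omega] at h2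
    nlinarith [h1, h2]
  have hlev1 : ∑ i ∈ Finset.range 2, h.choose i = h + 1 := by
    simp [Finset.sum_range_succ, add_comm]
  rw [hlev1] at hs₁ hs₂
  -- `n ≤ 2^h`
  have hn2 : n ≤ 2 ^ h := by
    have h1 := Nat.pow_sub_le_descFactorial h 5
    rw [Nat.descFactorial_eq_factorial_mul_choose, show Nat.factorial 5 = 120 by rfl,
      show h + 1 - 5 = h - 4 by omega] at h1
    have h2 := (arith21_pow h s₁ s₂ (by omega) (by nlinarith) (by nlinarith)).trans h1
    have h3 := Nat.choose_le_two_pow h 5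
    rw [hn]
    omega
  by_cases h7 : 7 * (s₂ + 1) ≤ s₁
  · -- LOPSIDED: levels (2,1) inside `a = ⌊√(2 s₁)⌋ - 1` coordinates
    set q := Nat.sqrt (2 * s₁) with hqdef
    have hq1 : q * q ≤ 2 * s₁ := Nat.sqrt_le _
    have hq2 : 2 * s₁ < (q + 1) * (q + 1) := Nat.lt_succ_sqrt _
    have hqh : q ≤ h := by nlinarith
    have hq10 : 2 ^ 10 ≤ q := by nlinarith
    set a := q - 1 with hadef
    have ha : a ≤ h := by omega
    have hlop := arith11_lopsided s₁ s₂ q hq10 hq1 hq2 h7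
    have hdesc : (q - 4) ^ 4 ≤ 24 * a.choose 4 := by
      have h1 := Nat.pow_sub_le_descFactorial a 4
      rw [Nat.descFactorial_eq_factorial_mul_choose, show Nat.factorial 4 = 24 by rfl,
        show a + 1 - 4 = q - 4 by omega] at h1
      exact h1
    have hnC4 : n ≤ a.choose 4 := by
      have : 24 * n ≤ 24 * a.choose 4 := by rw [hn]; exact hlop.trans hdesc
      omega
    have hn2a : n ≤ 2 ^ a := hnC4.trans (Nat.choose_le_two_pow a 4)
    have hnC : n ≤ ∑ i ∈ Finset.range 5, a.choose i :=
      hnC4.trans (Finset.single_le_sum (f := fun i => a.choose i) (fun i _ => Nat.zero_le _)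
        (Finset.mem_range.mpr (by norm_num : 4 < 5)))
    let emb : Fin a ↪ Fin h := Fin.castLEEmb ha
    set A : Finset (Fin h) := (Finset.univ : Finset (Fin a)).map emb with hA
    have hAcard : A.card = a := by simp [hA]
    let v : Fin n → Finset (Fin h) := fun i => (rowsSmallFirst a 5 n hn2a i).map emb
    have hv : Function.Injective v := by
      intro i i' hii'
      exact rowsSmallFirst_injective a 5 n hn2a ((Finset.map_injective emb) hii')
    refine ⟨v, hv, fun T => ?_⟩
    refine det_eq_zero_of_two_slots_levels_rank h 2 1 1 D N n A v S e he hlive 0 f₁ f₂ hf ?_ T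
    have hall : ∀ i, (rowsSmallFirst a 5 n hn2a i).card < 5 := by
      have hsmall := card_small_rowsSmallFirst a 5 n hn2a
      rw [min_eq_left hnC] at hsmall
      have heq : (Finset.univ.filter fun i : Fin n => (rowsSmallFirst a 5 n hn2a i).card < 5) = Finset.univ :=
        Finset.eq_univ_of_card _ (le_antisymm (Finset.card_filter_le _ _ |>.trans (by simp)) (by simpa using hsmall))
      intro i
      have : i ∈ (Finset.univ.filter fun i : Fin n => (rowsSmallFirst a 5 n hn2a i).card < 5) := by
        rw [heq]; exact Finset.mem_univ i
      exact (Finset.mem_filter.mp this).2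
    have hSmall : (Finset.univ.filter fun i : Fin n => v i ⊆ A ∧ (v i).card ≤ 2 + 1 + 1) = Finset.univ := by
      refine Finset.eq_univ_of_forall fun i => Finset.mem_filter.mpr ⟨Finset.mem_univ _, ?_, ?_⟩
      · exact Finset.map_subset_map.mpr (Finset.subset_univ _)
      · have := hall i
        simp only [v, Finset.card_map]
        omega
    rw [hSmall, Finset.card_univ, Fintype.card_fin, hAcard]
    -- levels: slot 1 deep at level 2 (`2·C(a,≤2) = a² + a + 2 = q² − q + 2 ≤ 2 s₁`), slot 2 at level 1 (`a + 1 = q ≤ h < s₂`)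
    have hlev₁ : ∑ i ∈ Finset.range 3, a.choose i ≤ s₁ := by
      have h1 := Nat.descFactorial_eq_factorial_mul_choose a 2
      have h2 : a.descFactorial 2 = (a - 1) * a := by simp [Nat.descFactorial_succ]
      simp only [Nat.factorial_two] at h1
      simp only [Finset.sum_range_succ, Finset.sum_range_zero, Nat.choose_zero_right, Nat.choose_one_right, zero_add]
      obtain ⟨k, hk⟩ : ∃ k, a = k + 1 := ⟨a - 1, by omega⟩
      rw [hk] at h1 h2 ⊢
      rw [show k + 1 - 1 = k by omega] at h2
      have hkq : q = k + 2 := by omega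
      rw [hkq] at hq1
      nlinarith [h1, h2, hq1]
    have hlev₂ : ∑ i ∈ Finset.range 2, a.choose i ≤ s₂ := by
      simp only [Finset.sum_range_succ, Finset.sum_range_zero, Nat.choose_zero_right, Nat.choose_one_right, zero_add]
      omega
    have hx₁ : 1 ≤ s₁ + 1 - ∑ i ∈ Finset.range 3, a.choose i := by omega
    have hx₂ : 1 ≤ s₂ + 1 - ∑ i ∈ Finset.range 2, a.choose i := by omega
    have := Nat.mul_le_mul hx₁ hx₂
    show n < n + (s₁ + 1 - ∑ i ∈ Finset.range 3, a.choose i) * (s₂ + 1 - ∑ i ∈ Finset.range 2, a.choose i)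
    omega
  · push Not at h7
    by_cases hβ : (s₁ + 1) * (s₂ + 1) < ∑ i ∈ Finset.range 4, h.choose i + (s₁ - h) * (s₂ - h)
    · -- MODERATE: rank form (1,1) at `univ` with the `n` smallest rows
      refine ⟨rowsSmallFirst h 4 n hn2, rowsSmallFirst_injective h 4 n hn2, fun T => ?_⟩
      refine det_eq_zero_of_two_slots_levels_rank h 1 1 1 D N n Finset.univ (rowsSmallFirst h 4 n hn2) S e he hlive 0 f₁ f₂ hf
        ?_ T
      have hsmall := card_small_rowsSmallFirst h 4 n hn2
      have hsub : (Finset.univ.filter fun i : Fin n => (rowsSmallFirst h 4 n hn2 i).card < 4) ⊆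
          (Finset.univ.filter fun i : Fin n => rowsSmallFirst h 4 n hn2 i ⊆ Finset.univ ∧
            (rowsSmallFirst h 4 n hn2 i).card ≤ 1 + 1 + 1) := by
        intro i hi
        simp only [Finset.mem_filter, Finset.mem_univ, true_and, Finset.subset_univ] at hi ⊢
        omega
      have hcard := Finset.card_le_card hsub
      simp only [Finset.card_univ, Fintype.card_fin]
      rw [hlev1]
      have hx : (s₁ + 1 - (h + 1)) * (s₂ + 1 - (h + 1)) = (s₁ - h) * (s₂ - h) := by
        congr 1 <;> omega
      rw [hx]
      have hx1 : 1 ≤ (s₁ - h) * (s₂ - h) := Nat.mul_le_mul (by omega : 1 ≤ s₁ - h) (by omega : 1 ≤ s₂ - h)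
      rcases le_total n (∑ i ∈ Finset.range 4, h.choose i) with hle | hle
      · rw [min_eq_left hle] at hsmall
        calc n < n + 1 := Nat.lt_succ_self _
          _ ≤ _ := Nat.add_le_add (hsmall.trans hcard) hx1
      · rw [min_eq_right hle] at hsmall
        calc n = (s₁ + 1) * (s₂ + 1) := hn
          _ < _ := hβ
          _ ≤ _ := Nat.add_le_add_right (hsmall.trans hcard) _
    · -- WIDE: levels (2,2) inside `a = ⌊√s₂⌋` coordinates
      push Not at hβ
      set a := Nat.sqrt s₂ with hadef
      have ha2 : a * a ≤ s₂ := Nat.sqrt_le s₂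
      have ha2' : s₂ < (a + 1) * (a + 1) := Nat.lt_succ_sqrt s₂
      have ha : a ≤ h := by nlinarith
      -- the key inequality `(h-2)^3 ≤ 48 (h+1) (a+1)²`
      have hkey : (h - 2) ^ 3 ≤ 48 * (h + 1) * ((a + 1) * (a + 1)) := by
        have h1 := Nat.pow_sub_le_descFactorial h 3
        rw [Nat.descFactorial_eq_factorial_mul_choose, show Nat.factorial 3 = 6 by rfl,
          show h + 1 - 3 = h - 2 by omega] at h1
        have h2 : h.choose 3 ≤ ∑ i ∈ Finset.range 4, h.choose i :=
          Finset.single_le_sum (f := fun i => h.choose i) (fun i _ => Nat.zero_le _) (Finset.mem_range.mpr (by norm_num : 3 < 4))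
        -- `C(h,≤3) ≤ (s₁+1)(s₂+1) − (s₁−h)(s₂−h) = (h+1)(s₁+s₂+1−h) ≤ 8 (h+1) (s₂+1)`
        obtain ⟨x₁, hx₁⟩ : ∃ x₁, s₁ = x₁ + h := ⟨s₁ - h, by omega⟩
        obtain ⟨x₂, hx₂⟩ : ∃ x₂, s₂ = x₂ + h := ⟨s₂ - h, by omega⟩
        rw [hx₁, hx₂, show x₁ + h - h = x₁ by omega, show x₂ + h - h = x₂ by omega] at hβ
        rw [hx₁, hx₂] at h7
        rw [hx₂] at ha2'
        have hexp : (x₁ + h + 1) * (x₂ + h + 1) = x₁ * x₂ + (h + 1) * (x₁ + x₂ + h + 1) := by ring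
        rw [hexp] at hβ
        have h3 : ∑ i ∈ Finset.range 4, h.choose i ≤ (h + 1) * (x₁ + x₂ + h + 1) := by omega
        have h4a : x₁ + x₂ + h + 1 ≤ 8 * (x₂ + h + 1) := by omega
        have h4b : x₂ + h + 1 ≤ (a + 1) * (a + 1) := Nat.succ_le_of_lt ha2'
        have h4 : (h + 1) * (x₁ + x₂ + h + 1) ≤ (h + 1) * (8 * ((a + 1) * (a + 1))) :=
          Nat.mul_le_mul_left _ (h4a.trans (Nat.mul_le_mul_left 8 h4b))
        have h5 : (h + 1) * (8 * ((a + 1) * (a + 1))) * 6 = 48 * (h + 1) * ((a + 1) * (a + 1)) := by ring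
        omega
      have hwide := arith11_wide h (a + 1) hh hkey
      rw [show a + 1 - 5 = a - 4 by omega] at hwide
      have hdesc : (a - 4) ^ 5 ≤ 120 * a.choose 5 := by
        have h1 := Nat.pow_sub_le_descFactorial a 5
        rw [Nat.descFactorial_eq_factorial_mul_choose, show Nat.factorial 5 = 120 by rfl,
          show a + 1 - 5 = a - 4 by omega] at h1
        exact h1
      have hnC5 : n ≤ a.choose 5 := by
        have h3 : n ≤ 7 * (((a + 1) * (a + 1)) * ((a + 1) * (a + 1))) := by
          rw [hn]
          have h5 : s₁ + 1 ≤ 7 * (s₂ + 1) := by omega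
          have h6 : s₂ + 1 ≤ (a + 1) * (a + 1) := Nat.succ_le_of_lt ha2'
          calc (s₁ + 1) * (s₂ + 1) ≤ (7 * (s₂ + 1)) * (s₂ + 1) := Nat.mul_le_mul_right _ h5
            _ ≤ (7 * ((a + 1) * (a + 1))) * ((a + 1) * (a + 1)) := Nat.mul_le_mul (Nat.mul_le_mul_left _ h6) h6
            _ = _ := by ring
        have : 120 * n ≤ 120 * a.choose 5 := (Nat.mul_le_mul_left _ h3).trans (hwide.trans hdesc)
        omega
      have hn2a : n ≤ 2 ^ a := hnC5.trans (Nat.choose_le_two_pow a 5)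
      have hnC : n ≤ ∑ i ∈ Finset.range 6, a.choose i :=
        hnC5.trans (Finset.single_le_sum (f := fun i => a.choose i) (fun i _ => Nat.zero_le _)
          (Finset.mem_range.mpr (by norm_num : 5 < 6)))
      have ha8 : 8 ≤ a := by
        by_contra hlt
        have : a.choose 5 ≤ 2 ^ a := Nat.choose_le_two_pow a 5
        have h128 : 2 ^ a ≤ 2 ^ 7 := Nat.pow_le_pow_right (by norm_num) (by omega)
        have hnpos : (h + 1 + 1) * (h + 1 + 1) ≤ n := by rw [hn]; exact Nat.mul_le_mul (by omega) (by omega)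
        have hsq : h + 1 + 1 ≤ (h + 1 + 1) * (h + 1 + 1) := Nat.le_mul_self _
        omega
      let emb : Fin a ↪ Fin h := Fin.castLEEmb ha
      set A : Finset (Fin h) := (Finset.univ : Finset (Fin a)).map emb with hA
      have hAcard : A.card = a := by simp [hA]
      let v : Fin n → Finset (Fin h) := fun i => (rowsSmallFirst a 6 n hn2a i).map emb
      have hv : Function.Injective v := by
        intro i i' hii'
        exact rowsSmallFirst_injective a 6 n hn2a ((Finset.map_injective emb) hii')
      refine ⟨v, hv, fun T => ?_⟩
      refine det_eq_zero_of_two_slots_levels_rank h 2 2 1 D N n A v S e he hlive 0 f₁ f₂ hf ?_ T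
      have hall : ∀ i, (rowsSmallFirst a 6 n hn2a i).card < 6 := by
        have hsmall := card_small_rowsSmallFirst a 6 n hn2a
        rw [min_eq_left hnC] at hsmall
        have heq : (Finset.univ.filter fun i : Fin n => (rowsSmallFirst a 6 n hn2a i).card < 6) = Finset.univ :=
          Finset.eq_univ_of_card _ (le_antisymm (Finset.card_filter_le _ _ |>.trans (by simp)) (by simpa using hsmall))
        intro i
        have : i ∈ (Finset.univ.filter fun i : Fin n => (rowsSmallFirst a 6 n hn2a i).card < 6) := by
          rw [heq]; exact Finset.mem_univ i
        exact (Finset.mem_filter.mp this).2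
      have hSmall : (Finset.univ.filter fun i : Fin n => v i ⊆ A ∧ (v i).card ≤ 2 + 2 + 1) = Finset.univ := by
        refine Finset.eq_univ_of_forall fun i => Finset.mem_filter.mpr ⟨Finset.mem_univ _, ?_, ?_⟩
        · exact Finset.map_subset_map.mpr (Finset.subset_univ _)
        · have := hall i
          simp only [v, Finset.card_map]
          omega
      rw [hSmall, Finset.card_univ, Fintype.card_fin, hAcard]
      have hlev : ∑ i ∈ Finset.range 3, a.choose i ≤ s₂ := (sum_choose_three_le_sq a (by omega)).trans ha2
      have hx₁ : 1 ≤ s₁ + 1 - ∑ i ∈ Finset.range 3, a.choose i :=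
        Nat.le_sub_of_add_le (by rw [add_comm]; exact Nat.add_le_add_right (hlev.trans hs₂₁) 1)
      have hx₂ : 1 ≤ s₂ + 1 - ∑ i ∈ Finset.range 3, a.choose i :=
        Nat.le_sub_of_add_le (by rw [add_comm]; exact Nat.add_le_add_right hlev 1)
      have := Nat.mul_le_mul hx₁ hx₂
      show n < n + (s₁ + 1 - ∑ i ∈ Finset.range 3, a.choose i) * (s₂ + 1 - ∑ i ∈ Finset.range 3, a.choose i)
      exact Nat.lt_add_of_pos_right (by rw [one_mul] at this; exact this)

end Summit.ValiantsHypothesis.ValiantsHypothesis.Theorems.BarrierLever.SimplexJoin
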